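import Summits.BirchSwinnertonDyer.BirchSwinnertonDyer.Theorems.AdditiveKolyvaginRoadLevelSystemsCoreConnected
import Summits.BirchSwinnertonDyer.BirchSwinnertonDyer.Theorems.AdditiveKolyvaginRoadIso
import Summits.BirchSwinnertonDyer.BirchSwinnertonDyer.Theorems.AdditiveKolyvaginRoadKolyvaginPerf
import Summits.BirchSwinnertonDyer.BirchSwinnertonDyer.Theorems.AdditiveKolyvaginRoadKolyvaginLine
import Summits.BirchSwinnertonDyer.BirchSwinnertonDyer.Theorems.AdditiveKolyvaginRoadKolyvaginTransverseIsotropy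
import Summits.BirchSwinnertonDyer.BirchSwinnertonDyer.Theorems.AdditiveKolyvaginRoadLocalDictionaries
import Literature.NumberTheory.EllipticCurves.HeegnerPointsKolyvaginCebotarevProofs
import HarnessLib

/-!
# Route `AdditiveKolyvaginRoad`, crux KS′ `LevelKolyvaginSystemsAdditive` (item stmt-BirchSwinnertonDyer-21396):
# the TWIN DICHOTOMY for the mixed Selmer spaces, DROP HALF (Howard 2004 Lemma 2.5.3 (a)) — Poitou–Tate-FREE, in the kernel
# (cell `pub/bsd-wall`, width seat `bsd-wall-akr-p2x-w2` g6; `--supports stmt-BirchSwinnertonDyer-21396`, helper; discharges the binder `hDrop` of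
# this seat's `nonempty_levelKolyvaginSystemP_of_seed_of_twin` ∕ `levelKolyvaginSystemsAdditive_of_kolyvaginPrimitive_of_twin`)

WHY. `nonempty_levelKolyvaginSystemP_of_seed_of_twin` (p625738) gives the fibre of crux KS′ at any frame from ONE seed, Poitou–Tate, odd bottom
rank and the TWIN DICHOTOMY for the mixed spaces `Sel(m, n)^μ ⊂ H¹(K, E[p])` (Kummer off `m ∪ n`, toric on the admissible level `n`, transverse on
the Kolyvagin conductor `m`) at a Kolyvagin prime `ℓ ∉ m`: three binders `hDrop`, `hRise`, `hJump` (Howard, Compositio 140 (2004) Lemma 2.5.3).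
THIS FILE proves `hDrop` — for EVERY level `n` (the non-emptiness is not used), every sign, any reduction type at `p`:
* §1 bookkeeping: a Kolyvagin prime is not an admissible prime (`p ∣ ℓ + 1`, `p ∤ q² − 1`); distinct rational primes lie under distinct places
  (tree `not_natCast_mem_of_prime_ne`).
* §2 `weilCupProduct_eq_zero_of_mixedRelaxed` — the local Weil terms of two classes of the `λ`-RELAXED mixed structure vanish at every place
  `w ≠ λ` (Kummer isotropy — Poonen–Rains, DISCHARGED in the tree; toric isotropy on the augmentation line above `n`; transverse isotropy above
  `m`, `cupProduct_eq_zero_of_mem_transverseLocalKerP`) — the `hA` input of the Poitou–Tate see-saw `Iso.weilCupProduct_localization_eq_zero_of_forall_ne`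
  (Tate reciprocity for the totally complex `K`, a tree THEOREM).
* §3 `twinDrop_mixed` — THE RESULT, literally the `hDrop` binder for a family `Mix` given by its membership dictionary: if a class of `Sel(m, n)^μ` is
  detected above `ℓ`, then `Sel(mℓ, n)^μ` is exactly the part of `Sel(m, n)^μ` locally trivial above `ℓ`, of codimension ONE. A transverse class
  detected at `λ` would pair non-trivially with the detected Kummer class ((Perf) `cupProduct_ne_zero_of_selmer_of_transverse_P`, Gross Prop. 8.1–8.2)
  against reciprocity; the memberships then differ only at `λ`; rank–nullity against the Kummer eigen-line (`exists_kummerEigenLine_P`, transported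
  to the `torsionLocMap` model by `Iso.exists_addMonoidHom_comp_localization_eq_torsionLocMap`).

WHAT REMAINS of (Twin): `hRise` ∕ `hJump` — the Poitou–Tate jump for the `λ`-relaxed mixed structure at a non-empty level (tree
`hjump_of_poitouTateP`), the eigen-decomposition, (IsoBound), and the local trichotomy «an isotropic `μ`-eigenclass at a Kolyvagin place not Kummer
there is TRANSVERSE there» (Gross's symmetric Frobenius lift: `h1Eval_frob_eq_zero_of_cupProduct_self_eq_zero_P` + `χ(F)² = 1`).

HONEST FRAMING: theorems only; 0 definitions, 0 named facts, 0 `sorry`; NO Poitou–Tate fact is used (only the tree's reciprocity theorem for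
totally complex `K`). Closes nothing by itself. BSD is not proved by any of this; KS′ is OPEN.

References: [cite: Howard2004HeegnerKolyvagin, Lemma 2.5.3, Lemma 2.5.6] [cite: WZhang2014, Lemma 8.4, Prop. 5.4, §8.1]
[cite: GrossLMS1991, Prop. 8.1, Prop. 8.2, Prop. 9.6] [cite: MazurRubin2004, Prop. 1.3.2 (ii)] [cite: PoonenRains2012, Prop. 4.10]
[cite: MilneADT2006, Ch. I, Thm. 4.10(b)].
-/

set_option linter.dupNamespace false -- single-conjunct summit repeats the name by design

noncomputable section

open scoped Classical

namespace Summit.BirchSwinnertonDyer.BirchSwinnertonDyer.Theorems.AdditiveKoly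

open CategoryTheory WeierstrassCurve Field Function NumberField IsDedekindDomain
open Literature.NumberTheory.EllipticCurves Literature.NumberTheory.EllipticCurves.ModularForms
  Literature.NumberTheory.GaloisRepresentations Module
open Literature.NumberTheory.GaloisRepresentations.DiscreteGaloisModule (mu MuCarrier)
open Literature.NumberTheory.GaloisCohomology
open Summit.BirchSwinnertonDyer.Rank1Residual.X11b.Three.Koly.Method2
open Summit.BirchSwinnertonDyer.Rank1Residual.X11b.Three.Koly
open scoped ContRepresentation

variable (W : WeierstrassCurve ℚ) (K : Type) [Field K] [NumberField K] (p : ℕ) [W.IsElliptic] [W.IsGloballyMinimal]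
  [Fact p.Prime] (c : K ≃ₐ[ℚ] K) (ι : K →+* ℂ) [Module (ZMod p) (Vp W K p)]

/-! ## §1 A Kolyvagin prime is not an admissible prime -/

omit [W.IsElliptic] [Fact p.Prime] [Module (ZMod p) (Vp W K p)] in
/-- A Kolyvagin prime and a Bertolini–Darmon admissible prime are distinct (`p ∣ ℓ + 1` but `p ∤ q² − 1`).
[cite: WZhang2014, Notations (xii), (xiv)] -/
theorem kolyvaginPrime_ne_admQ [Fact p.Prime] (ℓ : {ℓ // Zhang2014.IsKolyvaginPrime (W.conductorNorm ℤ) W K p ℓ}) (q : AdmQ W K p) : (ℓ : ℕ) ≠ (q : ℕ) := by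
  intro h
  have hk : 1 ≤ Zhang2014.kolyvaginIndex W p (ℓ : ℕ) := ℓ.2.2.2.2.2.2
  have hdvd : p ^ 1 ∣ (ℓ : ℕ) + 1 := (Zhang2014.le_kolyvaginIndex_iff.mp hk).1
  rw [pow_one, h] at hdvd
  have hq : ¬ ((p : ℤ) ∣ ((q : ℕ) : ℤ) ^ 2 - 1) := q.2.2.2.2.1
  apply hq
  have : ((q : ℕ) : ℤ) ^ 2 - 1 = (((q : ℕ) : ℤ) + 1) * (((q : ℕ) : ℤ) - 1) := by ring
  rw [this]
  exact Dvd.dvd.mul_right (by exact_mod_cast hdvd) _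

/-! ## §2 The local Weil terms of the `λ`-relaxed mixed structure vanish away from `λ` -/

omit [Module (ZMod p) (Vp W K p)] in
/-- **Isotropy away from the relaxed Kolyvagin place** (the `hA` input of the Poitou–Tate see-saw for the MIXED structure): for two
classes Kummer at the infinite places and at the finite places under no prime of `m ∪ n ∪ {ℓ}`, TORIC above the admissible level `n` and
TRANSVERSE above the Kolyvagin conductor `m`, the local Weil cup products vanish at every place other than the place `v` of `ℓ`: Kummer
isotropy (Poonen–Rains, tree `cupProduct_eq_zero_of_mem_kummerSelmerStructure_of_fact`), toric isotropy above `n` (`e(L, L) = 0` on the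
augmentation line, `natCard_augmentation_le_of_admQ`), transverse isotropy above `m` (`cupProduct_eq_zero_of_mem_transverseLocalKerP`,
Mazur–Rubin Prop. 1.3.2 (ii)). [cite: WZhang2014, Prop. 5.4, §8.1] [cite: Howard2004HeegnerKolyvagin, Lemma 2.5.6]
[cite: PoonenRains2012, Prop. 4.10] [cite: MazurRubin2004, Prop. 1.3.2 (ii)] -/
theorem weilCupProduct_eq_zero_of_mixedRelaxed [∀ w : Place K, CompactSpace (absoluteGaloisGroup (Place.Completion w))]
    (hK : IsImaginaryQuadratic K) (hp2 : p ≠ 2)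
    (e : geomTorsion (W.baseChange K) ((p ^ 1 : ℕ) : ℤ) → geomTorsion (W.baseChange K) ((p ^ 1 : ℕ) : ℤ) → AlgebraicClosure K)
    (hμ : ∀ P Q, e P Q ^ (p ^ 1) = 1) (hadd₁ : ∀ P₁ P₂ Q, e (P₁ + P₂) Q = e P₁ Q * e P₂ Q)
    (hadd₂ : ∀ P Q₁ Q₂, e P (Q₁ + Q₂) = e P Q₁ * e P Q₂) (halt : ∀ Q, e Q Q = 1)
    (hgal : ∀ (σ : absoluteGaloisGroup K) (P Q : geomTorsion (W.baseChange K) ((p ^ 1 : ℕ) : ℤ)), σ • e P Q = e (σ • P) (σ • Q))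
    (m : Finset {ℓ // Zhang2014.IsKolyvaginPrime (W.conductorNorm ℤ) W K p ℓ}) (ℓ : {ℓ // Zhang2014.IsKolyvaginPrime (W.conductorNorm ℤ) W K p ℓ}) (n : Finset (AdmQ W K p))
    (v : HeightOneSpectrum (𝓞 K)) (hv : ((ℓ : ℕ) : 𝓞 K) ∈ v.asIdeal) {y z : Vp W K p}
    (hy : ((∀ w : InfinitePlace K, y ∈ selmerLocalKer (W.baseChange K) w.Completion ((p ^ 1 : ℕ) : ℤ)) ∧
      (∀ w : HeightOneSpectrum (𝓞 K), ((ℓ : ℕ) : 𝓞 K) ∉ w.asIdeal → (∀ ℓ' ∈ m, ((ℓ' : ℕ) : 𝓞 K) ∉ w.asIdeal) →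
        (∀ q ∈ n, ((q : ℕ) : 𝓞 K) ∉ w.asIdeal) → y ∈ selmerLocalKer (W.baseChange K) (w.adicCompletion K) ((p ^ 1 : ℕ) : ℤ)) ∧
      (∀ q ∈ n, ∀ w : HeightOneSpectrum (𝓞 K), ((q : ℕ) : 𝓞 K) ∈ w.asIdeal →
        y ∈ toricLocalKer (W.baseChange K) (w.adicCompletion K) ((p ^ 1 : ℕ) : ℤ)) ∧
      (∀ ℓ' ∈ m, ∀ w : HeightOneSpectrum (𝓞 K), ((ℓ' : ℕ) : 𝓞 K) ∈ w.asIdeal → y ∈ transverseLocalKerP W K p ι ℓ' w)))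
    (hz : ((∀ w : InfinitePlace K, z ∈ selmerLocalKer (W.baseChange K) w.Completion ((p ^ 1 : ℕ) : ℤ)) ∧
      (∀ w : HeightOneSpectrum (𝓞 K), ((ℓ : ℕ) : 𝓞 K) ∉ w.asIdeal → (∀ ℓ' ∈ m, ((ℓ' : ℕ) : 𝓞 K) ∉ w.asIdeal) →
        (∀ q ∈ n, ((q : ℕ) : 𝓞 K) ∉ w.asIdeal) → z ∈ selmerLocalKer (W.baseChange K) (w.adicCompletion K) ((p ^ 1 : ℕ) : ℤ)) ∧
      (∀ q ∈ n, ∀ w : HeightOneSpectrum (𝓞 K), ((q : ℕ) : 𝓞 K) ∈ w.asIdeal →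
        z ∈ toricLocalKer (W.baseChange K) (w.adicCompletion K) ((p ^ 1 : ℕ) : ℤ)) ∧
      (∀ ℓ' ∈ m, ∀ w : HeightOneSpectrum (𝓞 K), ((ℓ' : ℕ) : 𝓞 K) ∈ w.asIdeal → z ∈ transverseLocalKerP W K p ι ℓ' w))) :
    ∀ w : Place K, w ≠ Sum.inr v →
      (weilContPairingLocal (W.baseChange K) (p ^ 1) e hμ hadd₁ hadd₂ hgal w).cupProduct
        (galoisCohomology.localization ((W.baseChange K).torsionGaloisModule ((p ^ 1 : ℕ) : ℤ)) w 1 y)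
        (galoisCohomology.localization ((W.baseChange K).torsionGaloisModule ((p ^ 1 : ℕ) : ℤ)) w 1 z) = 0 := by
  have hp : p.Prime := Fact.out
  haveI : Fact (Nat.Prime (p ^ 1)) := ⟨by rw [pow_one]; exact hp⟩
  haveI hcs : ∀ (L : Type) [Field L], CompactSpace (absoluteGaloisGroup L) := fun L _ ↦ @absoluteGaloisGroup_compactSpace L _
  haveI : Finite (geomTorsion (W.baseChange K) ((p ^ 1 : ℕ) : ℤ)) := finite_geomTorsion_of_neZero (W.baseChange K) (p ^ 1)
  have hpZ : ((p ^ 1 : ℕ) : ℤ) ≠ 0 := by exact_mod_cast pow_ne_zero 1 hp.ne_zero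
  -- the place above the inert `ℓ` is unique
  have huniq : ∀ w : HeightOneSpectrum (𝓞 K), ((ℓ : ℕ) : 𝓞 K) ∈ w.asIdeal → w = v :=
    fun w hw ↦ placesAbove_eq_of_isPrime_span K ℓ.2.2.2.2.2.1 ℓ.2.1.ne_zero hv hw
  obtain ⟨hyinf, hyfin, hyord, hytr⟩ := hy
  obtain ⟨hzinf, hzfin, hzord, hztr⟩ := hz
  intro w hw
  -- Kummer isotropy at a place where both classes satisfy the Kummer condition
  have hKum : ∀ w : Place K,
      y ∈ selmerLocalKer (W.baseChange K) (Place.Completion w) ((p ^ 1 : ℕ) : ℤ) →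
      z ∈ selmerLocalKer (W.baseChange K) (Place.Completion w) ((p ^ 1 : ℕ) : ℤ) →
      (weilContPairingLocal (W.baseChange K) (p ^ 1) e hμ hadd₁ hadd₂ hgal w).cupProduct
        (galoisCohomology.localization ((W.baseChange K).torsionGaloisModule ((p ^ 1 : ℕ) : ℤ)) w 1 y)
        (galoisCohomology.localization ((W.baseChange K).torsionGaloisModule ((p ^ 1 : ℕ) : ℤ)) w 1 z) = 0 := by
    intro w hyw hzw
    rw [← comap_localization_kummerSelmerStructure] at hyw hzw
    exact (W.baseChange K).cupProduct_eq_zero_of_mem_kummerSelmerStructure_of_fact (p ^ 1) e hpZ w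
      (kummerClass_cupProduct_kummerClass_eq_zero_holds _) hμ hadd₁ hadd₂ halt hgal hyw hzw
  rcases w with w | w
  · -- infinite place: Kummer on both sides
    exact hKum (Sum.inl w) (hyinf w) (hzinf w)
  · have hwv : w ≠ v := fun h ↦ hw (by rw [h])
    have hℓw : ((ℓ : ℕ) : 𝓞 K) ∉ w.asIdeal := fun h ↦ hwv (huniq w h)
    by_cases hexq : ∃ q ∈ n, ((q : ℕ) : 𝓞 K) ∈ w.asIdeal
    · -- an admissible level prime below `w`: both classes are toric
      obtain ⟨q, hq, hqw⟩ := hexq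
      exact weilCupProduct_res_eq_zero_of_valued (W.baseChange K) (p ^ 1) (w.adicCompletion K) e hμ hadd₁ hadd₂ hgal _
        (fun S hS T hT ↦ weilPairingHom_eq_zero_of_mem_of_card_le (W.baseChange K) (p ^ 1) e hμ hadd₁ hadd₂ halt _
          (natCard_augmentation_le_of_admQ W K p hK.1 q w hqw) S T hS hT)
        (exists_valued_cocycle_of_mem_toricLocalKer (W.baseChange K) (p ^ 1) (w.adicCompletion K) (hyord q hq w hqw))
        (exists_valued_cocycle_of_mem_toricLocalKer (W.baseChange K) (p ^ 1) (w.adicCompletion K) (hzord q hq w hqw))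
    · push Not at hexq
      by_cases hexl : ∃ ℓ' ∈ m, ((ℓ' : ℕ) : 𝓞 K) ∈ w.asIdeal
      · -- a Kolyvagin conductor prime below `w`: both classes are transverse
        obtain ⟨ℓ', hℓ', hℓ'w⟩ := hexl
        exact cupProduct_eq_zero_of_mem_transverseLocalKerP W K p hK ι hp2 e hμ hadd₁ hadd₂ hgal ℓ' ℓ'.2 w hℓ'w y z
          (hytr ℓ' hℓ' w hℓ'w) (hztr ℓ' hℓ' w hℓ'w)
      · -- no prime of `m ∪ n ∪ {ℓ}` below `w`: Kummer on both sides
        push Not at hexl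
        exact hKum (Sum.inr w) (hyfin w hℓw hexl hexq) (hzfin w hℓw hexl hexq)

/-! ## §3 (Twin), DROP half: a detected Kummer class above `ℓ` at conductor `m` makes the conductor-`mℓ` space the strict part -/

/-- **(Twin) DROP HALF for the mixed spaces — Howard 2004 Lemma 2.5.3 (a), Poitou–Tate-FREE.** Frame: `K` imaginary quadratic, `p` odd,
`ρ̄_{E,p}` onto, `c ≠ 1` (any reduction type at `p`); `Mix` the mixed spaces through their membership dictionary, finite-dimensional. For a
Kolyvagin prime `ℓ ∉ m`, a level `n` and a sign `μ`: if some class of `Sel(m, n)^μ` is detected above `ℓ`, then `Sel(mℓ, n)^μ` is EXACTLY the part of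
`Sel(m, n)^μ` locally trivial above `ℓ`, of codimension one. Proof: a class `y ∈ Sel(mℓ, n)^μ` (transverse at `λ`) detected at `λ` would pair
non-trivially with the detected Kummer class `x` ((Perf), `cupProduct_ne_zero_of_selmer_of_transverse_P`), contradicting Tate reciprocity for the
`λ`-relaxed mixed structure (§2 + `Iso.weilCupProduct_localization_eq_zero_of_forall_ne`); the two memberships then differ only at `λ`, where
«locally trivial» implies both the Kummer and the transverse condition; codimension one by rank–nullity against the Kummer eigen-line at `λ`
(`exists_kummerEigenLine_P`). [cite: Howard2004HeegnerKolyvagin, Lemma 2.5.3] [cite: WZhang2014, Lemma 8.4, §8.1] [cite: GrossLMS1991, Prop. 8.2] -/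
theorem twinDrop_mixed (hK : IsImaginaryQuadratic K) (hp2 : p ≠ 2) (hsurj : W.HasSurjectiveModNGaloisRep p) (hc1 : c ≠ 1)
    (Mix : Finset {ℓ // Zhang2014.IsKolyvaginPrime (W.conductorNorm ℤ) W K p ℓ} → Finset (AdmQ W K p) → Bool → Submodule (ZMod p) (Vp W K p))
    (hMix : ∀ (m : Finset {ℓ // Zhang2014.IsKolyvaginPrime (W.conductorNorm ℤ) W K p ℓ}) (n : Finset (AdmQ W K p)) (μ : Bool) (x : Vp W K p),
      x ∈ Mix m n μ ↔ (conjAct W c ((p ^ 1 : ℕ) : ℤ) x = sgnP μ • x ∧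
        (∀ w : InfinitePlace K, x ∈ selmerLocalKer (W.baseChange K) w.Completion ((p ^ 1 : ℕ) : ℤ)) ∧
        (∀ v : HeightOneSpectrum (𝓞 K), (∀ ℓ ∈ m, ((ℓ : ℕ) : 𝓞 K) ∉ v.asIdeal) → (∀ q ∈ n, ((q : ℕ) : 𝓞 K) ∉ v.asIdeal) →
          x ∈ selmerLocalKer (W.baseChange K) (v.adicCompletion K) ((p ^ 1 : ℕ) : ℤ)) ∧
        (∀ q ∈ n, ∀ v : HeightOneSpectrum (𝓞 K), ((q : ℕ) : 𝓞 K) ∈ v.asIdeal →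
          x ∈ toricLocalKer (W.baseChange K) (v.adicCompletion K) ((p ^ 1 : ℕ) : ℤ)) ∧
        (∀ ℓ ∈ m, ∀ v : HeightOneSpectrum (𝓞 K), ((ℓ : ℕ) : 𝓞 K) ∈ v.asIdeal → x ∈ transverseLocalKerP W K p ι ℓ v)))
    (hfin : ∀ (m : Finset {ℓ // Zhang2014.IsKolyvaginPrime (W.conductorNorm ℤ) W K p ℓ}) (n : Finset (AdmQ W K p)) (μ : Bool), Module.Finite (ZMod p) (Mix m n μ)) :
    ∀ (m : Finset {ℓ // Zhang2014.IsKolyvaginPrime (W.conductorNorm ℤ) W K p ℓ}) (ℓ : {ℓ // Zhang2014.IsKolyvaginPrime (W.conductorNorm ℤ) W K p ℓ}) (n : Finset (AdmQ W K p)) (μ : Bool), ℓ ∉ m → n.Nonempty →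
      (∃ x ∈ Mix m n μ, ¬ (∀ v : HeightOneSpectrum (𝓞 K), ((ℓ : ℕ) : 𝓞 K) ∈ v.asIdeal → x ∈ (W.baseChange K).torsionLocalKer (v.adicCompletion K) ((p ^ 1 : ℕ) : ℤ))) →
      (∀ y, y ∈ Mix (insert ℓ m) n μ ↔ (y ∈ Mix m n μ ∧ (∀ v : HeightOneSpectrum (𝓞 K), ((ℓ : ℕ) : 𝓞 K) ∈ v.asIdeal → y ∈ (W.baseChange K).torsionLocalKer (v.adicCompletion K) ((p ^ 1 : ℕ) : ℤ)))) ∧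
        finrank (ZMod p) (Mix (insert ℓ m) n μ) + 1 = finrank (ZMod p) (Mix m n μ) := by
  intro m ℓ n μ hℓm _ hdet
  have hp : p.Prime := Fact.out
  haveI : Fact (Nat.Prime (p ^ 1)) := ⟨by rw [pow_one]; exact hp⟩
  haveI : IsTotallyComplex K := hK.2
  haveI hcs : ∀ (L : Type) [Field L], CompactSpace (absoluteGaloisGroup L) := fun L _ ↦ @absoluteGaloisGroup_compactSpace L _
  haveI : ∀ w : Place K, CompactSpace (absoluteGaloisGroup (Place.Completion w)) := fun w ↦ absoluteGaloisGroup_compactSpace _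
  haveI : Finite (geomTorsion (W.baseChange K) ((p ^ 1 : ℕ) : ℤ)) := finite_geomTorsion_of_neZero (W.baseChange K) (p ^ 1)
  obtain ⟨e, hμ, hadd₁, hadd₂, halt, hnondeg, hgal⟩ :=
    exists_weilPairing_holds (W.baseChange K) (p ^ 1) (by rw [pow_one]; exact hp.two_le) (by
      rw [pow_one]; exact_mod_cast hp.ne_zero)
  -- the detected class and the (unique) place above `ℓ`
  obtain ⟨x, hxA, hTx⟩ := hdet
  push Not at hTx
  obtain ⟨v, hv, hxv⟩ := hTx
  have huniq : ∀ w : HeightOneSpectrum (𝓞 K), ((ℓ : ℕ) : 𝓞 K) ∈ w.asIdeal → w = v :=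
    fun w hw ↦ placesAbove_eq_of_isPrime_span K ℓ.2.2.2.2.2.1 ℓ.2.1.ne_zero hv hw
  -- no prime of `m ∪ n` lies under `v`
  have hmv : ∀ ℓ' ∈ m, ((ℓ' : ℕ) : 𝓞 K) ∉ v.asIdeal := fun ℓ' hℓ' ↦
    not_natCast_mem_of_prime_ne (K := K) ℓ.2.1 ℓ'.2.1 (fun h ↦ hℓm (by rwa [show ℓ = ℓ' from Subtype.ext h])) v hv
  have hnv : ∀ q ∈ n, ((q : ℕ) : 𝓞 K) ∉ v.asIdeal := fun q _ ↦
    not_natCast_mem_of_prime_ne (K := K) ℓ.2.1 q.2.1 (kolyvaginPrime_ne_admQ W K p ℓ q) v hv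
  -- unpacking the two mixed spaces into the relaxed structure
  have hrelA : ∀ y ∈ Mix m n μ, ((∀ w : InfinitePlace K, y ∈ selmerLocalKer (W.baseChange K) w.Completion ((p ^ 1 : ℕ) : ℤ)) ∧
      (∀ w : HeightOneSpectrum (𝓞 K), ((ℓ : ℕ) : 𝓞 K) ∉ w.asIdeal → (∀ ℓ' ∈ m, ((ℓ' : ℕ) : 𝓞 K) ∉ w.asIdeal) →
        (∀ q ∈ n, ((q : ℕ) : 𝓞 K) ∉ w.asIdeal) → y ∈ selmerLocalKer (W.baseChange K) (w.adicCompletion K) ((p ^ 1 : ℕ) : ℤ)) ∧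
      (∀ q ∈ n, ∀ w : HeightOneSpectrum (𝓞 K), ((q : ℕ) : 𝓞 K) ∈ w.asIdeal →
        y ∈ toricLocalKer (W.baseChange K) (w.adicCompletion K) ((p ^ 1 : ℕ) : ℤ)) ∧
      (∀ ℓ' ∈ m, ∀ w : HeightOneSpectrum (𝓞 K), ((ℓ' : ℕ) : 𝓞 K) ∈ w.asIdeal → y ∈ transverseLocalKerP W K p ι ℓ' w)) := by
    intro y hy
    obtain ⟨-, h1, h2, h3, h4⟩ := (hMix m n μ y).mp hy
    exact ⟨h1, fun w _ hm hn ↦ h2 w hm hn, h3, h4⟩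
  have hrelB : ∀ y ∈ Mix (insert ℓ m) n μ, ((∀ w : InfinitePlace K, y ∈ selmerLocalKer (W.baseChange K) w.Completion ((p ^ 1 : ℕ) : ℤ)) ∧
      (∀ w : HeightOneSpectrum (𝓞 K), ((ℓ : ℕ) : 𝓞 K) ∉ w.asIdeal → (∀ ℓ' ∈ m, ((ℓ' : ℕ) : 𝓞 K) ∉ w.asIdeal) →
        (∀ q ∈ n, ((q : ℕ) : 𝓞 K) ∉ w.asIdeal) → y ∈ selmerLocalKer (W.baseChange K) (w.adicCompletion K) ((p ^ 1 : ℕ) : ℤ)) ∧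
      (∀ q ∈ n, ∀ w : HeightOneSpectrum (𝓞 K), ((q : ℕ) : 𝓞 K) ∈ w.asIdeal →
        y ∈ toricLocalKer (W.baseChange K) (w.adicCompletion K) ((p ^ 1 : ℕ) : ℤ)) ∧
      (∀ ℓ' ∈ m, ∀ w : HeightOneSpectrum (𝓞 K), ((ℓ' : ℕ) : 𝓞 K) ∈ w.asIdeal → y ∈ transverseLocalKerP W K p ι ℓ' w)) := by
    intro y hy
    obtain ⟨-, h1, h2, h3, h4⟩ := (hMix (insert ℓ m) n μ y).mp hy
    refine ⟨h1, fun w hℓw hm hn ↦ h2 w (fun ℓ'' hℓ'' ↦ ?_) hn, h3, fun ℓ' hℓ' w hw ↦ h4 ℓ' (Finset.mem_insert_of_mem hℓ') w hw⟩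
    rcases Finset.mem_insert.mp hℓ'' with rfl | hℓ''
    · exact hℓw
    · exact hm ℓ'' hℓ''
  -- the relaxed structure as a subgroup
  let R : AddSubgroup (Vp W K p) :=
    (⨅ w : InfinitePlace K, selmerLocalKer (W.baseChange K) w.Completion ((p ^ 1 : ℕ) : ℤ)) ⊓
    ((⨅ (w : HeightOneSpectrum (𝓞 K)) (_ : ((ℓ : ℕ) : 𝓞 K) ∉ w.asIdeal) (_ : ∀ ℓ' ∈ m, ((ℓ' : ℕ) : 𝓞 K) ∉ w.asIdeal)
        (_ : ∀ q ∈ n, ((q : ℕ) : 𝓞 K) ∉ w.asIdeal), selmerLocalKer (W.baseChange K) (w.adicCompletion K) ((p ^ 1 : ℕ) : ℤ)) ⊓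
     ((⨅ (q : AdmQ W K p) (_ : q ∈ n) (w : HeightOneSpectrum (𝓞 K)) (_ : ((q : ℕ) : 𝓞 K) ∈ w.asIdeal),
        toricLocalKer (W.baseChange K) (w.adicCompletion K) ((p ^ 1 : ℕ) : ℤ)) ⊓
      (⨅ (ℓ' : {ℓ // Zhang2014.IsKolyvaginPrime (W.conductorNorm ℤ) W K p ℓ}) (_ : ℓ' ∈ m) (w : HeightOneSpectrum (𝓞 K)) (_ : ((ℓ' : ℕ) : 𝓞 K) ∈ w.asIdeal),
        transverseLocalKerP W K p ι ℓ' w)))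
  have hR : ∀ y : Vp W K p, ((∀ w : InfinitePlace K, y ∈ selmerLocalKer (W.baseChange K) w.Completion ((p ^ 1 : ℕ) : ℤ)) ∧
      (∀ w : HeightOneSpectrum (𝓞 K), ((ℓ : ℕ) : 𝓞 K) ∉ w.asIdeal → (∀ ℓ' ∈ m, ((ℓ' : ℕ) : 𝓞 K) ∉ w.asIdeal) →
        (∀ q ∈ n, ((q : ℕ) : 𝓞 K) ∉ w.asIdeal) → y ∈ selmerLocalKer (W.baseChange K) (w.adicCompletion K) ((p ^ 1 : ℕ) : ℤ)) ∧
      (∀ q ∈ n, ∀ w : HeightOneSpectrum (𝓞 K), ((q : ℕ) : 𝓞 K) ∈ w.asIdeal →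
        y ∈ toricLocalKer (W.baseChange K) (w.adicCompletion K) ((p ^ 1 : ℕ) : ℤ)) ∧
      (∀ ℓ' ∈ m, ∀ w : HeightOneSpectrum (𝓞 K), ((ℓ' : ℕ) : 𝓞 K) ∈ w.asIdeal → y ∈ transverseLocalKerP W K p ι ℓ' w)) → y ∈ R := by
    rintro y ⟨h1, h2, h3, h4⟩
    change y ∈ _ ⊓ (_ ⊓ (_ ⊓ _))
    simp only [AddSubgroup.mem_inf, AddSubgroup.mem_iInf]
    exact ⟨h1, h2, h3, h4⟩
  have hR' : ∀ y ∈ R, ((∀ w : InfinitePlace K, y ∈ selmerLocalKer (W.baseChange K) w.Completion ((p ^ 1 : ℕ) : ℤ)) ∧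
      (∀ w : HeightOneSpectrum (𝓞 K), ((ℓ : ℕ) : 𝓞 K) ∉ w.asIdeal → (∀ ℓ' ∈ m, ((ℓ' : ℕ) : 𝓞 K) ∉ w.asIdeal) →
        (∀ q ∈ n, ((q : ℕ) : 𝓞 K) ∉ w.asIdeal) → y ∈ selmerLocalKer (W.baseChange K) (w.adicCompletion K) ((p ^ 1 : ℕ) : ℤ)) ∧
      (∀ q ∈ n, ∀ w : HeightOneSpectrum (𝓞 K), ((q : ℕ) : 𝓞 K) ∈ w.asIdeal →
        y ∈ toricLocalKer (W.baseChange K) (w.adicCompletion K) ((p ^ 1 : ℕ) : ℤ)) ∧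
      (∀ ℓ' ∈ m, ∀ w : HeightOneSpectrum (𝓞 K), ((ℓ' : ℕ) : 𝓞 K) ∈ w.asIdeal → y ∈ transverseLocalKerP W K p ι ℓ' w)) := by
    intro y hy
    change y ∈ _ ⊓ (_ ⊓ (_ ⊓ _)) at hy
    simp only [AddSubgroup.mem_inf, AddSubgroup.mem_iInf] at hy
    exact hy
  have hA : ∀ y ∈ R, ∀ z ∈ R, ∀ w : Place K, w ≠ Sum.inr v →
      (weilContPairingLocal (W.baseChange K) (p ^ 1) e hμ hadd₁ hadd₂ hgal w).cupProduct
        (galoisCohomology.localization ((W.baseChange K).torsionGaloisModule ((p ^ 1 : ℕ) : ℤ)) w 1 y)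
        (galoisCohomology.localization ((W.baseChange K).torsionGaloisModule ((p ^ 1 : ℕ) : ℤ)) w 1 z) = 0 :=
    fun y hy z hz ↦ weilCupProduct_eq_zero_of_mixedRelaxed W K p ι hK hp2 e hμ hadd₁ hadd₂ halt hgal m ℓ n v hv (hR' y hy) (hR' z hz)
  -- KEY: every class of the conductor-`mℓ` space is locally trivial at `v`
  have hxs : conjAct W c ((p ^ 1 : ℕ) : ℤ) x = sgnP μ • x := ((hMix m n μ x).mp hxA).1
  have hxK : x ∈ selmerLocalKer (W.baseChange K) (v.adicCompletion K) ((p ^ 1 : ℕ) : ℤ) := ((hMix m n μ x).mp hxA).2.2.1 v hmv hnv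
  have hkey : ∀ y ∈ Mix (insert ℓ m) n μ, y ∈ (W.baseChange K).torsionLocalKer (v.adicCompletion K) ((p ^ 1 : ℕ) : ℤ) := by
    intro y hy
    by_contra hy0
    have hys : conjAct W c ((p ^ 1 : ℕ) : ℤ) y = sgnP μ • y := ((hMix (insert ℓ m) n μ y).mp hy).1
    have hyT : y ∈ transverseLocalKerP W K p ι ℓ v := ((hMix (insert ℓ m) n μ y).mp hy).2.2.2.2 ℓ (Finset.mem_insert_self ℓ m) v hv
    have hne := cupProduct_ne_zero_of_selmer_of_transverse_P W K p hK hp2 hsurj ι hc1 e hμ hadd₁ hadd₂ halt hnondeg hgal ℓ.2 v hv μ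
      hxs hys hxK hxv hyT hy0
    exact hne (Iso.weilCupProduct_localization_eq_zero_of_forall_ne (W.baseChange K) (p ^ 1) e hμ hadd₁ hadd₂ hgal v R hA
      (hR x (hrelA x hxA)) (hR y (hrelB y hy)))
  -- the two memberships differ only at `v`
  have hdict : ∀ y, y ∈ Mix (insert ℓ m) n μ ↔ (y ∈ Mix m n μ ∧ (∀ v : HeightOneSpectrum (𝓞 K), ((ℓ : ℕ) : 𝓞 K) ∈ v.asIdeal → y ∈ (W.baseChange K).torsionLocalKer (v.adicCompletion K) ((p ^ 1 : ℕ) : ℤ))) := by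
    intro y
    constructor
    · intro hy
      have hy0 := hkey y hy
      obtain ⟨h0, h1, h2, h3, h4⟩ := (hMix (insert ℓ m) n μ y).mp hy
      refine ⟨(hMix m n μ y).mpr ⟨h0, h1, fun w hm hn ↦ ?_, h3, fun ℓ' hℓ' w hw ↦ h4 ℓ' (Finset.mem_insert_of_mem hℓ') w hw⟩,
        fun w hw ↦ by rw [huniq w hw]; exact hy0⟩
      by_cases hℓw : ((ℓ : ℕ) : 𝓞 K) ∈ w.asIdeal
      · rw [huniq w hℓw]
        exact (W.baseChange K).torsionLocalKer_le_selmerLocalKer (v.adicCompletion K) _ hy0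
      · refine h2 w (fun ℓ'' hℓ'' ↦ ?_) hn
        rcases Finset.mem_insert.mp hℓ'' with rfl | hℓ''
        · exact hℓw
        · exact hm ℓ'' hℓ''
    · rintro ⟨hy, hTy⟩
      obtain ⟨h0, h1, h2, h3, h4⟩ := (hMix m n μ y).mp hy
      refine (hMix (insert ℓ m) n μ y).mpr ⟨h0, h1, fun w hm hn ↦ h2 w (fun ℓ' hℓ' ↦ hm ℓ' (Finset.mem_insert_of_mem hℓ')) hn, h3,
        fun ℓ'' hℓ'' w hw ↦ ?_⟩
      rcases Finset.mem_insert.mp hℓ'' with rfl | hℓ''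
      · exact torsionLocalKer_le_transverseLocalKerP W K p ι _ w (hTy w hw)
      · exact h4 ℓ'' hℓ'' w hw
  refine ⟨hdict, ?_⟩
  -- codimension exactly one: rank–nullity against the Kummer eigen-line at `v`, in the `torsionLocMap` model
  set loc := (W.baseChange K).torsionLocMap (v.adicCompletion K) ((p ^ 1 : ℕ) : ℤ) with hloc
  haveI : Module (ZMod p) (discreteH1 (Field.absoluteGaloisGroup (v.adicCompletion K))
      (AddSubgroup.torsionBy (localPoints (W.baseChange K) (v.adicCompletion K)) ((p ^ 1 : ℕ) : ℤ))) :=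
    AddCommGroup.zmodModule (fun z ↦ by
      have h := zsmul_discreteH1_torsion ((p ^ 1 : ℕ) : ℤ) z
      rw [← natCast_zsmul]
      convert h using 2
      push_cast
      ring)
  set locZ := loc.toZModLinearMap p with hlocZ
  have hlocZ_apply : ∀ y : Vp W K p, locZ y = loc y := fun _ ↦ rfl
  -- the Kummer `μ`-eigen-line at `v`, transported to the `torsionLocMap` model
  obtain ⟨Φ, hΦ⟩ := Iso.exists_addMonoidHom_comp_localization_eq_torsionLocMap (W.baseChange K) (p ^ 1) v
  obtain ⟨e', he'⟩ := exists_kummerEigenLine_P W K p hK hp2 hsurj c hc1 ℓ ℓ.2 v hv μ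
  haveI : FiniteDimensional (ZMod p) (Mix m n μ) := hfin m n μ
  haveI : FiniteDimensional (ZMod p) (Submodule.span (ZMod p) ({Φ e'} : Set _)) :=
    FiniteDimensional.span_of_finite (ZMod p) (Set.finite_singleton _)
  have hfr : finrank (ZMod p) ↥(Mix m n μ ⊓ LinearMap.ker locZ) + 1 = finrank (ZMod p) (Mix m n μ) := by
    refine ZhangInduction.finrank_inf_ker_add_one_of_line (Mix m n μ) locZ (Submodule.span (ZMod p) {Φ e'})
      ((finrank_span_le_card _).trans (le_of_eq (by rw [Set.toFinset_card, Set.card_singleton]))) ?_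
      ⟨x, hxA, by rw [hlocZ_apply]; exact fun h ↦ hxv (AddMonoidHom.mem_ker.mpr h)⟩
    intro y hy
    obtain ⟨a, ha⟩ := he' y ((hMix m n μ y).mp hy).1 (((hMix m n μ y).mp hy).2.2.1 v hmv hnv)
    rw [Submodule.mem_span_singleton]
    refine ⟨(a : ZMod p), ?_⟩
    rw [hlocZ_apply, hloc, ← hΦ y, ha, map_zsmul, Int.cast_smul_eq_zsmul]
  have heq : Mix (insert ℓ m) n μ = Mix m n μ ⊓ LinearMap.ker locZ := by
    ext y
    rw [Submodule.mem_inf, LinearMap.mem_ker, hlocZ_apply, hdict y]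
    constructor
    · rintro ⟨hy, hTy⟩
      exact ⟨hy, AddMonoidHom.mem_ker.mp (hTy v hv)⟩
    · rintro ⟨hy, hy0⟩
      exact ⟨hy, fun w hw ↦ by rw [huniq w hw]; exact AddMonoidHom.mem_ker.mpr hy0⟩
  rw [heq]
  exact hfr

end Summit.BirchSwinnertonDyer.BirchSwinnertonDyer.Theorems.AdditiveKoly

end
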